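import Summits.BirchSwinnertonDyer.BirchSwinnertonDyer.Theorems.EisensteinPrimesMazurMCOnCellBTwistbackTwoStepDefs
import Summits.BirchSwinnertonDyer.BirchSwinnertonDyer.Theorems.EisensteinPrimesMazurMCOnCellBTwistbackOnePartnerAt
import HarnessLib

/-!
# Crux 3 `MazurMCOnCellB` (stmt-BirchSwinnertonDyer-19033), line `twistback` v7 — ROAD (e) ALONG CHAINS: `BSD(E,p)`,
# Mazur's main conjecture and the stub's (∃-PARTNER) clause at an X2b pair `(W, p)` from a `BSD_p` / Ш-unit end
# REACHABLE AT ANY DISTANCE along certified two-step edges `TwoStepAt p`, every datum discharged, both signs at `p`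

Width seat bsd-line-x2-p1-w6 (gen 3), cell `bsd-eis`, 2026-08-28; `--supports stmt-BirchSwinnertonDyer-19033 --as helper`;
companion of `…TwistbackTwoStepDefs` (same seat: the edge `TwoStepAt p W W″` and the X2b-propagation bookkeeping).
HONEST FRAMING: conditional theorems only; no `def`, no named fact introduced, no `sorry`; closes no registered stub; no
summit statement, no Mazur main conjecture and no BSD is proved for any curve unconditionally; 0 cells / labels / stubs /
tiers move. Whether every X2b pair REACHES a unit end (idea-12's `UnitAnchorSupply`) is OPEN and not claimed.

## What

The registered skeleton (twistback v7, LEAD g13) derives its one open stub's conclusion on X2b pairs carrying a two-step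
Ш-unit datum — a unit end at distance EXACTLY one edge (x2-p1-w6 g2 p662647, `upperPartner_ofUnitEnd`). Idea-12's
`anchor` line (workfile `Cruxes/MazurMCOnCellB/Lines/anchor.lean`, not importable) proved that Mazur's main conjecture
propagates BACKWARDS along any finite chain of certified two-steps, with STEP L, co-STEP L and both Heegner data carried
as hypotheses of each edge. Here the same induction runs over the data-DISCHARGED edge `TwoStepAt p` of the companion
module, on x2-p1-w6 g2's per-edge transfer `…TwistbackOnePartnerAt.bsdp_of_cellB_of_twoStepBSDp` (p663790 §2):

* §1 `bsdp_of_cellB_of_reflTransGen_twoStepAt_of_bsdp`: `X2.CellB W p`, `Relation.ReflTransGen (TwoStepAt p) W W″`,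
  `BSDp W″ p` ⟹ `BSDp W p` (induction `Relation.ReflTransGen.head_induction_on`; X2b is carried along the chain by
  `cellB_of_cellB_of_twoStepAt`). `…_of_shaAn_unit`: the far end a Ш-UNIT end (`#Ш_an(W″)` a rational `p`-unit) —
  Wuthrich 2014 Prop. 21 closes `BSD_p(W″)` at the rank-zero X2b pair `(W″, p)`
  (`Wuthrich2014.bsdp_of_L_one_ne_zero_of_padicValRat_shaAn_eq_zero`), then §1. Distance `0` (`W″ = W`) included.
* §2 `mazurMainConjectureAt_of_cellB_of_reflTransGen_twoStepAt_of_{bsdp,shaAn_unit}`: the same with the conclusion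
  `X2.MazurMainConjectureAt W p` (the exact converse `X2.mazurMainConjectureAt_of_bsdp_of_red` at `(W, p)`).
* §3 `upperPartner_at_of_cellB_of_transGen_twoStepAt_of_{bsdp,shaAn_unit}`: for a chain of length `≥ 1`
  (`Relation.TransGen`) the (∃-PARTNER) clause of `stub_upperPartnerOffSubrowNoUnitEnd` AT `(W, p)` VERBATIM — witness
  the first edge's `K`; `BSDp` at the first edge's far end by §1, at the partner `Wd` by crux 4's twist-partner door
  (`bsdp_partner_of_twoStepBSDp`), at EVERY globally minimal model of `E^{(d_K)}` by Cassels
  (`X2.bsdp_of_isIsogenous_of_bsdp`), hence `Typed.MissingUpperBoundAt` there. `…_of_exists_transGen_shaAn_unit`: the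
  same from the packed hypothesis «∃ a Ш-unit end reachable at distance `≥ 1`» — the shape a reshape narrowing 6″ to
  «no REACHABLE unit end» would hand to `upperPartner_all` (the v7 excluded datum implies it:
  `…TwoStepDefs.exists_transGen_twoStepAt_shaAn_unit_of_twoStepShaUnitDatum`).

HYPOTHESES BY NAME (nothing asserted): `PublishedInputs` (stmt-…-19037), Poitou–Tate ×2 (THEOREMS in the tree, fed as
terms by the skeleton's `poitouTate_pair`), Hsieh 2014 Thm. 1, Liu–Zhang–Zhang 2018, Mazur 1978 Cor. 4.1 (PUBLISHED /
refereed; conjuncts of stubs 1–2), Keller–Yin 2024 Thm. D (stub 3a; UNREFEREED PREPRINT), and for the unit ends Wuthrich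
2014 Prop. 21 `sha_dvd_analyticSha` (stub 2 conjunct (2k), PUBLISHED). PER CHAIN: the fields, models and readings packed
in each `TwoStepAt` edge, and at the far end ONE exact rational `#Ш_an` reading with `ord_p = 0` (or `BSDp`). NO `p`-adic
`L`-function, NO height / Schneider, NO exceptional leading term, NO class number / line datum.

CENSUS BEARING (numbers are idea-12's, `Cruxes/MazurMCOnCellB/ANCHOR-CENSUS-g8.md` rev 3, not mine): at `p = 3` unit
ends ONE edge away exist for 46/46 computed X2b classes (`N ≤ 900`, `|d_K d_{K″}| ≤ 79993`); 7/53 classes have no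
admissible edge with `4√N·|d d″| ≤ 8·10⁶` series terms (kit targets). Longer chains are what the reachability form adds;
no class is known to need one. CLASS-WIDE the supply is OPEN (LEAD g13 verdict §2 (i), §7).

PRIOR ART (delta): idea-12 `Lines/anchor.lean` `anchor_of_reflTransGen` (workfile; edge = LEAD g7 UnitLever §4 p627870
WITH STEP L / co-STEP L / Heegner data as hypotheses; conclusion MC only); x2-p1-w6 g2 p662647 / p663790 (ONE edge, data
discharged). Here: any finite chain, data discharged, and the STUB's (∃-PARTNER) shape — not in the tree before.

References: [KellerYin2024] Thm. D (PRE); [Wuthrich2014] Thm. 16, Prop. 21; [CastellaEtAl2021] Thm. 5.3.1;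
[JetchevSkinnerWan2017] §7.4.1; [LiuZhangZhang2018]; [Hsieh2014] Thm. 1; [Mazur1978] Cor. 4.1; [MilneADT2006] Thm. I.7.3;
[Miller2011LMS] Def. 1.1; [GreenbergVatsal2000] remark after Thm. (1.3).
-/

set_option autoImplicit false
-- `Summit.BirchSwinnertonDyer.BirchSwinnertonDyer.…`: the summit and its single sub-problem share a name.
set_option linter.dupNamespace false

noncomputable section

open scoped Classical MatrixGroups ModularForm

open CongruenceSubgroup WeierstrassCurve NumberField
  Literature.NumberTheory.EllipticCurves
  Literature.NumberTheory.EllipticCurves.ModularForms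
  Literature.NumberTheory.QuadraticFields
  Literature.NumberTheory.EllipticCurves.Rank1Residual
  Literature.NumberTheory.EllipticCurves.Rank1Residual.Typed
  Literature.NumberTheory.EllipticCurves.Wuthrich2014
  Literature.NumberTheory.EllipticCurves.SteinWuthrich2013
  Literature.NumberTheory.EllipticCurves.GreenbergVatsal2000
  Literature.NumberTheory.EllipticCurves.KellerYin2024
  Literature.NumberTheory.GaloisCohomology
  Summit.BirchSwinnertonDyer.Rank1Residual
  Summit.BirchSwinnertonDyer.BirchSwinnertonDyer.Theses
  Summit.BirchSwinnertonDyer.BirchSwinnertonDyer.Theorems.EisensteinPrimesMazurMCOnCellBTwistbackTwoStepDefs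
  Summit.BirchSwinnertonDyer.BirchSwinnertonDyer.Theorems.EisensteinPrimesMazurMCOnCellBTwistbackOnePartnerAt

namespace Summit.BirchSwinnertonDyer.BirchSwinnertonDyer.Theorems.EisensteinPrimesMazurMCOnCellBTwistbackTwoStepChain

/-! ## §1. `BSD(E,p)` at `(W, p)` from a `BSD_p` / Ш-unit end reachable along a chain of edges -/

/-- **`BSD_p` propagates backwards along any finite chain of certified two-step edges.** For an X2b pair `(W, p)`, a
chain `Relation.ReflTransGen (TwoStepAt p) W W″` (length `≥ 0`; each edge carries its fields `K, K″`, minimal models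
`Wd`, far end, and the readings `r_an(E^{(d_K)}) = 1`, `L(Wd^{(d_{K″})},1) ≠ 0`) and `BSDp W″ p`: `BSDp W p`. Induction
on the chain from the head (`Relation.ReflTransGen.head_induction_on`): each near end is X2b
(`…TwoStepDefs.cellB_of_cellB_of_twoStepAt`, modularity from `PublishedInputs`), and one edge is x2-p1-w6 g2's
`…TwistbackOnePartnerAt.bsdp_of_cellB_of_twoStepBSDp` (crux 4's twist-partner door at `(Wd, K″)` — value atom LZZ, IMC
atoms Keller–Yin Thm. D —, then the per-pair core at `(W, K)`: optimal curve, Heegner datum/point, STEP L from item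
-27489 ⟸ Thm. D, Cassels). CONDITIONAL on the named facts; nothing about any curve is proved unconditionally.
[claim: KellerYin2024, status: under-review] [cite: KellerYin2024, Thm. D = Thm. 5.1.3 (arXiv:2402.12781v2 L306–L309)]
[cite: CastellaEtAl2021, Thm. 5.3.1 and (5.5)–(5.7)] [cite: LiuZhangZhang2018, Thms. 1.5.1 and 1.5.3]
[cite: Hsieh2014, Thm. 1] [cite: Mazur1978, Cor. 4.1] [cite: MilneADT2006, Thm. I.7.3] [cite: Miller2011LMS, Def. 1.1] -/
theorem bsdp_of_cellB_of_reflTransGen_twoStepAt_of_bsdp (hP : EisensteinPrimes.PublishedInputs)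
    (hPT : ∀ (K : Type) [Field K] [NumberField K], poitouTate_selmerStructure_duality K)
    (hPT2 : ∀ (K : Type) [Field K] [NumberField K], poitouTate_sha_tateDual K)
    (hH : hsieh2014_exists_anticyclotomicPAdicLFunction)
    (hF : LiuZhangZhang2018.thm151_thm153_modularCurve_heegnerVector) (hMaz : mazur_not_dvd_maninConstant_of_odd)
    (hD : KellerYin2024.thmD_imcMult_exists_isBDPLFunction_isTorsion_charIdeal_eq_OPEN)
    {p : ℕ} [Fact p.Prime] {W W'' : WeierstrassCurve ℚ} [W.IsElliptic] [W.IsGloballyMinimal]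
    [W''.IsElliptic] [W''.IsGloballyMinimal] (hc : X2.CellB W p)
    (h : Relation.ReflTransGen (TwoStepAt p) W W'') (hbsd : BSDp W'' p) : BSDp W p := by
  have hnf := hP.2.2.2.2.2.1
  have hE : WeierstrassCurve.hasEntireLFunction_rat :=
    WeierstrassCurve.hasEntireLFunction_rat_of_exists_isNewformOf hnf
  have key : ∀ {a : WeierstrassCurve ℚ}, Relation.ReflTransGen (TwoStepAt p) a W'' →
      ∀ (_ : a.IsElliptic) (_ : a.IsGloballyMinimal), X2.CellB a p → BSDp a p := by
    intro a ha
    induction ha using Relation.ReflTransGen.head_induction_on with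
    | refl => intro _ _ _; exact hbsd
    | @head a b hab hbW ih =>
      intro _ _ hca
      obtain ⟨_, _, _, _, K, _, _, hK, hHN, hHp, hodd, hlt, hr1, Wd, _, _, hWd, K'', _, _, hK'', hodd'', hlt'', hHN'',
        hHp'', hL'', hW''⟩ := id hab
      have hcb : X2.CellB b p := cellB_of_cellB_of_twoStepAt hE hca hab
      have hbsdb : BSDp b p := ih inferInstance inferInstance hcb
      exact bsdp_of_cellB_of_twoStepBSDp hP hPT hPT2 hH hF hMaz hD a p hca K hK hHN hHp hodd hlt hr1 Wd hWd K'' hK''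
        hodd'' hlt'' hHN'' hHp'' hL'' b hW'' hbsdb
  exact key h inferInstance inferInstance hc

/-- **`BSD(E,p)` at an X2b pair from a Ш-UNIT END reachable along a chain** (length `≥ 0`): the far end `(W″, p)` is an
X2b pair (`cellB_of_cellB_of_reflTransGen_twoStepAt`), so `r_an(W″) = 0`, `p` odd multiplicative, `E″[p]` reducible, and
ONE exact rational reading `ord_p #Ш_an(W″) = 0` closes `BSD_p(W″)` by Wuthrich 2014 Prop. 21
(`Wuthrich2014.bsdp_of_L_one_ne_zero_of_padicValRat_shaAn_eq_zero`); then `bsdp_of_cellB_of_reflTransGen_twoStepAt_of_bsdp`.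
= road (e) (x2-p1-w6 g2 p662647, ONE edge) at ANY distance; at distance `0` it is Prop. 21 at `(W, p)` itself.
CONDITIONAL on the named facts. [claim: KellerYin2024, status: under-review] [cite: Wuthrich2014, Prop. 21 (p. 400)]
[cite: KellerYin2024, Thm. D = Thm. 5.1.3] [cite: Miller2011LMS, Def. 1.1] -/
theorem bsdp_of_cellB_of_reflTransGen_twoStepAt_of_shaAn_unit (hP : EisensteinPrimes.PublishedInputs)
    (hW21 : sha_dvd_analyticSha)
    (hPT : ∀ (K : Type) [Field K] [NumberField K], poitouTate_selmerStructure_duality K)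
    (hPT2 : ∀ (K : Type) [Field K] [NumberField K], poitouTate_sha_tateDual K)
    (hH : hsieh2014_exists_anticyclotomicPAdicLFunction)
    (hF : LiuZhangZhang2018.thm151_thm153_modularCurve_heegnerVector) (hMaz : mazur_not_dvd_maninConstant_of_odd)
    (hD : KellerYin2024.thmD_imcMult_exists_isBDPLFunction_isTorsion_charIdeal_eq_OPEN)
    {p : ℕ} [Fact p.Prime] {W W'' : WeierstrassCurve ℚ} [W.IsElliptic] [W.IsGloballyMinimal]
    [W''.IsElliptic] [W''.IsGloballyMinimal] (hc : X2.CellB W p)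
    (h : Relation.ReflTransGen (TwoStepAt p) W W'')
    (hunit : ∃ q : ℚ, shaAn W'' = (q : ℂ) ∧ padicValRat p q = 0) : BSDp W p := by
  have hnf := hP.2.2.2.2.2.1
  have hGZK := hP.2.2.2.2.2.2.2.2.2.2.1
  have hE : WeierstrassCurve.hasEntireLFunction_rat :=
    WeierstrassCurve.hasEntireLFunction_rat_of_exists_isNewformOf hnf
  have hc'' : X2.CellB W'' p := cellB_of_cellB_of_reflTransGen_twoStepAt hE hc h
  have hL1 : W''.entireLFunction 1 ≠ 0 := (W''.analyticRank_eq_zero_iff_holds (hE W'')).1 hc''.1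
  have hbsd'' : BSDp W'' p :=
    Wuthrich2014.bsdp_of_L_one_ne_zero_of_padicValRat_shaAn_eq_zero hW21 hGZK W'' p hc''.2.1.1 hL1
      (WeierstrassCurve.HasMultiplicativeReduction.not_hasAdditiveReduction _ hc''.2.1.2.2) (Or.inl hc''.2.1.2.1)
      hunit
  exact bsdp_of_cellB_of_reflTransGen_twoStepAt_of_bsdp hP hPT hPT2 hH hF hMaz hD hc h hbsd''

/-! ## §2. Mazur's main conjecture at `(W, p)` from a reachable `BSD_p` / Ш-unit end -/

/-- **Mazur's main conjecture at an X2b pair from `BSD_p` reachable along a chain**: §1 and the exact converse at a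
rank-zero reducible multiplicative pair `X2.mazurMainConjectureAt_of_bsdp_of_red` (Wuthrich Thm. 16, Stein–Wuthrich
Thm. 6.1, Greenberg–Stevens, GZK — `PublishedInputs` conjuncts). CONDITIONAL; a main conjecture is proved for no curve.
[claim: KellerYin2024, status: under-review] [cite: Wuthrich2014, Thm. 16 and §5 (p. 397)]
[cite: SteinWuthrich2013, Thm. 6.1 (p. 20)] [cite: Miller2011LMS, Def. 1.1] -/
theorem mazurMainConjectureAt_of_cellB_of_reflTransGen_twoStepAt_of_bsdp (hP : EisensteinPrimes.PublishedInputs)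
    (hPT : ∀ (K : Type) [Field K] [NumberField K], poitouTate_selmerStructure_duality K)
    (hPT2 : ∀ (K : Type) [Field K] [NumberField K], poitouTate_sha_tateDual K)
    (hH : hsieh2014_exists_anticyclotomicPAdicLFunction)
    (hF : LiuZhangZhang2018.thm151_thm153_modularCurve_heegnerVector) (hMaz : mazur_not_dvd_maninConstant_of_odd)
    (hD : KellerYin2024.thmD_imcMult_exists_isBDPLFunction_isTorsion_charIdeal_eq_OPEN)
    {p : ℕ} [Fact p.Prime] {W W'' : WeierstrassCurve ℚ} [W.IsElliptic] [W.IsGloballyMinimal]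
    [W''.IsElliptic] [W''.IsGloballyMinimal] (hc : X2.CellB W p)
    (h : Relation.ReflTransGen (TwoStepAt p) W W'') (hbsd : BSDp W'' p) : X2.MazurMainConjectureAt W p := by
  have hnf := hP.2.2.2.2.2.1
  have hGZK := hP.2.2.2.2.2.2.2.2.2.2.1
  have hWu := hP.2.2.2.2.2.2.2.2.2.2.2.2.2.2.1
  have hJs := hP.2.2.2.2.2.2.2.2.2.2.2.2.2.2.2.1
  have hJn := hP.2.2.2.2.2.2.2.2.2.2.2.2.2.2.2.2.1
  have hHs := hP.2.2.2.2.2.2.2.2.2.2.2.2.2.2.2.2.2.1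
  have hHn := hP.2.2.2.2.2.2.2.2.2.2.2.2.2.2.2.2.2.2.1
  have hGS := hP.2.2.2.2.2.2.2.2.2.2.2.2.2.2.2.2.2.2.2
  have hE : WeierstrassCurve.hasEntireLFunction_rat :=
    WeierstrassCurve.hasEntireLFunction_rat_of_exists_isNewformOf hnf
  exact X2.mazurMainConjectureAt_of_bsdp_of_red hWu hJs hJn hHs hHn hGZK hE W p (hGS W p) hc.2.1.1 hc.2.1.2.2
    hc.2.1.2.1 hc.1 (bsdp_of_cellB_of_reflTransGen_twoStepAt_of_bsdp hP hPT hPT2 hH hF hMaz hD hc h hbsd)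

/-- **Mazur's main conjecture at an X2b pair from a Ш-UNIT END reachable along a chain** (length `≥ 0`): §1
(`…_of_shaAn_unit`) and `X2.mazurMainConjectureAt_of_bsdp_of_red`. = idea-12's `anchor_of_reflTransGen ∘ anchor_of_unit`
with every edge datum discharged to the named facts. CONDITIONAL; a main conjecture is proved for no curve.
[claim: KellerYin2024, status: under-review] [cite: Wuthrich2014, Thm. 16 (p. 397) and Prop. 21 (p. 400)]
[cite: SteinWuthrich2013, Thm. 6.1 (p. 20)] [cite: Miller2011LMS, Def. 1.1] -/
theorem mazurMainConjectureAt_of_cellB_of_reflTransGen_twoStepAt_of_shaAn_unit (hP : EisensteinPrimes.PublishedInputs)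
    (hW21 : sha_dvd_analyticSha)
    (hPT : ∀ (K : Type) [Field K] [NumberField K], poitouTate_selmerStructure_duality K)
    (hPT2 : ∀ (K : Type) [Field K] [NumberField K], poitouTate_sha_tateDual K)
    (hH : hsieh2014_exists_anticyclotomicPAdicLFunction)
    (hF : LiuZhangZhang2018.thm151_thm153_modularCurve_heegnerVector) (hMaz : mazur_not_dvd_maninConstant_of_odd)
    (hD : KellerYin2024.thmD_imcMult_exists_isBDPLFunction_isTorsion_charIdeal_eq_OPEN)
    {p : ℕ} [Fact p.Prime] {W W'' : WeierstrassCurve ℚ} [W.IsElliptic] [W.IsGloballyMinimal]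
    [W''.IsElliptic] [W''.IsGloballyMinimal] (hc : X2.CellB W p)
    (h : Relation.ReflTransGen (TwoStepAt p) W W'')
    (hunit : ∃ q : ℚ, shaAn W'' = (q : ℂ) ∧ padicValRat p q = 0) : X2.MazurMainConjectureAt W p := by
  have hnf := hP.2.2.2.2.2.1
  have hGZK := hP.2.2.2.2.2.2.2.2.2.2.1
  have hWu := hP.2.2.2.2.2.2.2.2.2.2.2.2.2.2.1
  have hJs := hP.2.2.2.2.2.2.2.2.2.2.2.2.2.2.2.1
  have hJn := hP.2.2.2.2.2.2.2.2.2.2.2.2.2.2.2.2.1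
  have hHs := hP.2.2.2.2.2.2.2.2.2.2.2.2.2.2.2.2.2.1
  have hHn := hP.2.2.2.2.2.2.2.2.2.2.2.2.2.2.2.2.2.2.1
  have hGS := hP.2.2.2.2.2.2.2.2.2.2.2.2.2.2.2.2.2.2.2
  have hE : WeierstrassCurve.hasEntireLFunction_rat :=
    WeierstrassCurve.hasEntireLFunction_rat_of_exists_isNewformOf hnf
  exact X2.mazurMainConjectureAt_of_bsdp_of_red hWu hJs hJn hHs hHn hGZK hE W p (hGS W p) hc.2.1.1 hc.2.1.2.2
    hc.2.1.2.1 hc.1 (bsdp_of_cellB_of_reflTransGen_twoStepAt_of_shaAn_unit hP hW21 hPT hPT2 hH hF hMaz hD hc h hunit)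

/-! ## §3. The stub's (∃-PARTNER) clause AT `(W, p)` from an end reachable at distance `≥ 1` -/

/-- **The (∃-PARTNER) clause of `stub_upperPartnerOffSubrowNoUnitEnd` AT `(W, p)` VERBATIM, from `BSD_p` reachable
at distance `≥ 1`.** Data: an X2b pair `(W, p)`, a NON-empty chain `Relation.TransGen (TwoStepAt p) W W″`, `BSDp W″ p`.
Witness: the FIRST edge's field `K` (`Relation.TransGen.head'_iff`). `BSDp` at the first edge's far end by §1 (the rest of
the chain, `ReflTransGen`), at the first edge's partner `Wd` by crux 4's twist-partner door
(`…TwistbackOnePartnerAt.bsdp_partner_of_twoStepBSDp`), at EVERY globally minimal model of `E^{(d_K)}` by Cassels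
(`X2.bsdp_of_isIsogenous_of_bsdp` along `isIsogenous_of_smul_eq`), hence `Typed.MissingUpperBoundAt` there (`BSDp ⟹
MissingPPartAt ⟹ both halves`, `Ш` finite by GZK). CONDITIONAL on the named facts.
[claim: KellerYin2024, status: under-review] [cite: KellerYin2024, Thm. D = Thm. 5.1.3 (arXiv:2402.12781v2 L306–L309)]
[cite: CastellaEtAl2021, Thm. 5.3.1] [cite: MilneADT2006, Thm. I.7.3 (Cassels)] [cite: Miller2011LMS, Def. 1.1] -/
theorem upperPartner_at_of_cellB_of_transGen_twoStepAt_of_bsdp (hP : EisensteinPrimes.PublishedInputs)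
    (hPT : ∀ (K : Type) [Field K] [NumberField K], poitouTate_selmerStructure_duality K)
    (hPT2 : ∀ (K : Type) [Field K] [NumberField K], poitouTate_sha_tateDual K)
    (hH : hsieh2014_exists_anticyclotomicPAdicLFunction)
    (hF : LiuZhangZhang2018.thm151_thm153_modularCurve_heegnerVector) (hMaz : mazur_not_dvd_maninConstant_of_odd)
    (hD : KellerYin2024.thmD_imcMult_exists_isBDPLFunction_isTorsion_charIdeal_eq_OPEN)
    {p : ℕ} [Fact p.Prime] {W W'' : WeierstrassCurve ℚ} [W.IsElliptic] [W.IsGloballyMinimal]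
    [W''.IsElliptic] [W''.IsGloballyMinimal] (hc : X2.CellB W p)
    (h : Relation.TransGen (TwoStepAt p) W W'') (hbsd : BSDp W'' p) :
    ∃ (K : Type) (_ : Field K) (_ : NumberField K), IsImaginaryQuadratic K ∧
      SatisfiesHeegnerHypothesis (W.conductorNorm ℤ) K ∧ SatisfiesHeegnerHypothesis p K ∧
      Odd (NumberField.discr K) ∧ NumberField.discr K < -4 ∧
      (W.quadraticTwist (NumberField.discr K : ℚ)).analyticRank = 1 ∧
      ∀ (Wd : WeierstrassCurve ℚ) [Wd.IsElliptic] [Wd.IsGloballyMinimal],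
        (∃ C : VariableChange ℚ, C • Wd = W.quadraticTwist (NumberField.discr K : ℚ)) →
        MissingUpperBoundAt Wd p := by
  have hCassels := hP.2.1
  have hnf := hP.2.2.2.2.2.1
  have hGZK := hP.2.2.2.2.2.2.2.2.2.2.1
  have hE : WeierstrassCurve.hasEntireLFunction_rat :=
    WeierstrassCurve.hasEntireLFunction_rat_of_exists_isNewformOf hnf
  obtain ⟨W₁, h₁, h₁''⟩ := Relation.TransGen.head'_iff.mp h
  obtain ⟨_, _, _, _, K, _, _, hK, hHN, hHp, hoddK, hlt, hr1, Wd, _, _, ⟨C, hC⟩, K'', _, _, hK'', hodd'', hlt'', hHN'',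
    hHp'', hL'', hW₁⟩ := id h₁
  have hc₁ : X2.CellB W₁ p := cellB_of_cellB_of_twoStepAt hE hc h₁
  have hbsd₁ : BSDp W₁ p := bsdp_of_cellB_of_reflTransGen_twoStepAt_of_bsdp hP hPT hPT2 hH hF hMaz hD hc₁ h₁'' hbsd
  have hrd : Wd.analyticRank = 1 := by
    have h := congrArg WeierstrassCurve.analyticRank hC
    rw [analyticRank_smul] at h
    exact h.trans hr1
  have hbsdd : BSDp Wd p :=
    bsdp_partner_of_twoStepBSDp hP hPT hPT2 hH hF hMaz hD W p hc.2.1 K hK hHp Wd ⟨C, hC⟩ hrd K'' hK'' hodd'' hlt''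
      hHN'' hHp'' hL'' W₁ hW₁ hbsd₁
  refine ⟨K, inferInstance, inferInstance, hK, hHN, hHp, hoddK, hlt, hr1, fun Wd' _ _ hWd' ↦ ?_⟩
  obtain ⟨C', hC'⟩ := hWd'
  have hrd' : Wd'.analyticRank = 1 := by
    have h := congrArg WeierstrassCurve.analyticRank hC'
    rw [analyticRank_smul] at h
    exact h.trans hr1
  have hiso : IsIsogenous Wd Wd' := (isIsogenous_of_smul_eq hC).trans' (isIsogenous_of_smul_eq' hC')
  have hbsd' : BSDp Wd' p :=
    X2.bsdp_of_isIsogenous_of_bsdp hCassels hGZK hE Wd Wd' hiso p (le_of_eq hrd) hbsdd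
  haveI : Finite Wd'.sha := (hGZK Wd' (le_of_eq hrd')).2
  exact (lower_and_upper_of_missingPPartAt Wd' p (missingPPartAt_of_bsdp Wd' p hbsd')).2

/-- **The (∃-PARTNER) clause AT `(W, p)` from a Ш-UNIT END reachable at distance `≥ 1`**: the far end is X2b
(`cellB_of_cellB_of_reflTransGen_twoStepAt`), Wuthrich 2014 Prop. 21 closes `BSD_p(W″)` from the ONE rational reading
`ord_p #Ш_an(W″) = 0`, then `upperPartner_at_of_cellB_of_transGen_twoStepAt_of_bsdp`. At distance EXACTLY `1` this is
x2-p1-w6 g2's `…TwistbackTwoStepShaUnit.upperPartner_at_of_twoStepShaUnit` (p662647 §2) = the skeleton's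
`upperPartner_ofUnitEnd`. CONDITIONAL on the named facts; the existence of such a chain out of every X2b pair is OPEN
(idea-12 `UnitAnchorSupply`) and not claimed. [claim: KellerYin2024, status: under-review]
[cite: Wuthrich2014, Prop. 21 (p. 400)] [cite: KellerYin2024, Thm. D = Thm. 5.1.3] [cite: MilneADT2006, Thm. I.7.3]
[cite: Miller2011LMS, Def. 1.1] -/
theorem upperPartner_at_of_cellB_of_transGen_twoStepAt_of_shaAn_unit (hP : EisensteinPrimes.PublishedInputs)
    (hW21 : sha_dvd_analyticSha)
    (hPT : ∀ (K : Type) [Field K] [NumberField K], poitouTate_selmerStructure_duality K)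
    (hPT2 : ∀ (K : Type) [Field K] [NumberField K], poitouTate_sha_tateDual K)
    (hH : hsieh2014_exists_anticyclotomicPAdicLFunction)
    (hF : LiuZhangZhang2018.thm151_thm153_modularCurve_heegnerVector) (hMaz : mazur_not_dvd_maninConstant_of_odd)
    (hD : KellerYin2024.thmD_imcMult_exists_isBDPLFunction_isTorsion_charIdeal_eq_OPEN)
    {p : ℕ} [Fact p.Prime] {W W'' : WeierstrassCurve ℚ} [W.IsElliptic] [W.IsGloballyMinimal]
    [W''.IsElliptic] [W''.IsGloballyMinimal] (hc : X2.CellB W p)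
    (h : Relation.TransGen (TwoStepAt p) W W'')
    (hunit : ∃ q : ℚ, shaAn W'' = (q : ℂ) ∧ padicValRat p q = 0) :
    ∃ (K : Type) (_ : Field K) (_ : NumberField K), IsImaginaryQuadratic K ∧
      SatisfiesHeegnerHypothesis (W.conductorNorm ℤ) K ∧ SatisfiesHeegnerHypothesis p K ∧
      Odd (NumberField.discr K) ∧ NumberField.discr K < -4 ∧
      (W.quadraticTwist (NumberField.discr K : ℚ)).analyticRank = 1 ∧
      ∀ (Wd : WeierstrassCurve ℚ) [Wd.IsElliptic] [Wd.IsGloballyMinimal],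
        (∃ C : VariableChange ℚ, C • Wd = W.quadraticTwist (NumberField.discr K : ℚ)) →
        MissingUpperBoundAt Wd p := by
  have hnf := hP.2.2.2.2.2.1
  have hGZK := hP.2.2.2.2.2.2.2.2.2.2.1
  have hE : WeierstrassCurve.hasEntireLFunction_rat :=
    WeierstrassCurve.hasEntireLFunction_rat_of_exists_isNewformOf hnf
  have hc'' : X2.CellB W'' p := cellB_of_cellB_of_reflTransGen_twoStepAt hE hc h.to_reflTransGen
  have hL1 : W''.entireLFunction 1 ≠ 0 := (W''.analyticRank_eq_zero_iff_holds (hE W'')).1 hc''.1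
  have hbsd'' : BSDp W'' p :=
    Wuthrich2014.bsdp_of_L_one_ne_zero_of_padicValRat_shaAn_eq_zero hW21 hGZK W'' p hc''.2.1.1 hL1
      (WeierstrassCurve.HasMultiplicativeReduction.not_hasAdditiveReduction _ hc''.2.1.2.2) (Or.inl hc''.2.1.2.1)
      hunit
  exact upperPartner_at_of_cellB_of_transGen_twoStepAt_of_bsdp hP hPT hPT2 hH hF hMaz hD hc h hbsd''

/-- **The door a «no REACHABLE unit end» reshape would call** (the shape `upperPartner_all`'s excluded branch takes):
at an X2b pair `(W, p)`, the packed hypothesis «some Ш-unit end `W″` is reachable at distance `≥ 1`»,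
`∃ W″ (elliptic, globally minimal), Relation.TransGen (TwoStepAt p) W W″ ∧ ∃ q, #Ш_an(W″) = q ∧ ord_p q = 0`, gives the
stub's (∃-PARTNER) clause at `(W, p)`. The registered v7 datum implies this hypothesis
(`…TwoStepDefs.exists_transGen_twoStepAt_shaAn_unit_of_twoStepShaUnitDatum`), so a stub negating it is WEAKER than
`stub_upperPartnerOffSubrowNoUnitEnd`; whether to register that is the LEAD's call, not this file's. CONDITIONAL on the
named facts. [claim: KellerYin2024, status: under-review] [cite: Wuthrich2014, Prop. 21 (p. 400)]
[cite: KellerYin2024, Thm. D = Thm. 5.1.3] [cite: Miller2011LMS, Def. 1.1] -/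
theorem upperPartner_at_of_cellB_of_exists_transGen_shaAn_unit (hP : EisensteinPrimes.PublishedInputs)
    (hW21 : sha_dvd_analyticSha)
    (hPT : ∀ (K : Type) [Field K] [NumberField K], poitouTate_selmerStructure_duality K)
    (hPT2 : ∀ (K : Type) [Field K] [NumberField K], poitouTate_sha_tateDual K)
    (hH : hsieh2014_exists_anticyclotomicPAdicLFunction)
    (hF : LiuZhangZhang2018.thm151_thm153_modularCurve_heegnerVector) (hMaz : mazur_not_dvd_maninConstant_of_odd)
    (hD : KellerYin2024.thmD_imcMult_exists_isBDPLFunction_isTorsion_charIdeal_eq_OPEN)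
    (W : WeierstrassCurve ℚ) [W.IsElliptic] [W.IsGloballyMinimal] (p : ℕ) [Fact p.Prime] (hc : X2.CellB W p)
    (he : ∃ (W'' : WeierstrassCurve ℚ) (_ : W''.IsElliptic) (_ : W''.IsGloballyMinimal),
      Relation.TransGen (TwoStepAt p) W W'' ∧ ∃ q : ℚ, shaAn W'' = (q : ℂ) ∧ padicValRat p q = 0) :
    ∃ (K : Type) (_ : Field K) (_ : NumberField K), IsImaginaryQuadratic K ∧
      SatisfiesHeegnerHypothesis (W.conductorNorm ℤ) K ∧ SatisfiesHeegnerHypothesis p K ∧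
      Odd (NumberField.discr K) ∧ NumberField.discr K < -4 ∧
      (W.quadraticTwist (NumberField.discr K : ℚ)).analyticRank = 1 ∧
      ∀ (Wd : WeierstrassCurve ℚ) [Wd.IsElliptic] [Wd.IsGloballyMinimal],
        (∃ C : VariableChange ℚ, C • Wd = W.quadraticTwist (NumberField.discr K : ℚ)) →
        MissingUpperBoundAt Wd p := by
  obtain ⟨W'', _, _, h, hunit⟩ := he
  exact upperPartner_at_of_cellB_of_transGen_twoStepAt_of_shaAn_unit hP hW21 hPT hPT2 hH hF hMaz hD hc h hunit

/-- **Mazur's main conjecture at `(W, p)` from the packed hypothesis «some Ш-unit end reachable at distance `≥ 0`»**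
(the empty chain included: then it is Prop. 21 at `(W, p)`, `X2.mazurMainConjectureAt_of_cellB_of_shaAn_unit`): the
shape a composition testing reachability BEFORE the (∃-PARTNER) stub would call. CONDITIONAL on the named facts; a
main conjecture is proved for no curve. [claim: KellerYin2024, status: under-review]
[cite: Wuthrich2014, Thm. 16 (p. 397) and Prop. 21 (p. 400)] [cite: SteinWuthrich2013, Thm. 6.1 (p. 20)] -/
theorem mazurMainConjectureAt_of_cellB_of_exists_reflTransGen_shaAn_unit (hP : EisensteinPrimes.PublishedInputs)
    (hW21 : sha_dvd_analyticSha)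
    (hPT : ∀ (K : Type) [Field K] [NumberField K], poitouTate_selmerStructure_duality K)
    (hPT2 : ∀ (K : Type) [Field K] [NumberField K], poitouTate_sha_tateDual K)
    (hH : hsieh2014_exists_anticyclotomicPAdicLFunction)
    (hF : LiuZhangZhang2018.thm151_thm153_modularCurve_heegnerVector) (hMaz : mazur_not_dvd_maninConstant_of_odd)
    (hD : KellerYin2024.thmD_imcMult_exists_isBDPLFunction_isTorsion_charIdeal_eq_OPEN)
    (W : WeierstrassCurve ℚ) [W.IsElliptic] [W.IsGloballyMinimal] (p : ℕ) [Fact p.Prime] (hc : X2.CellB W p)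
    (he : ∃ (W'' : WeierstrassCurve ℚ) (_ : W''.IsElliptic) (_ : W''.IsGloballyMinimal),
      Relation.ReflTransGen (TwoStepAt p) W W'' ∧ ∃ q : ℚ, shaAn W'' = (q : ℂ) ∧ padicValRat p q = 0) :
    X2.MazurMainConjectureAt W p := by
  obtain ⟨W'', _, _, h, hunit⟩ := he
  exact mazurMainConjectureAt_of_cellB_of_reflTransGen_twoStepAt_of_shaAn_unit hP hW21 hPT hPT2 hH hF hMaz hD hc h hunit

end Summit.BirchSwinnertonDyer.BirchSwinnertonDyer.Theorems.EisensteinPrimesMazurMCOnCellBTwistbackTwoStepChain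

end
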